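import Literature.Claims.NS.Ershkov2015
import Literature.Analysis.FluidPDE.ClaySettingParasiticDrift
import Literature.Analysis.FluidPDE.NSLerayHopf
import Literature.Analysis.FluidPDE.KNSSAxisymmetricNoSwirl
import Literature.Analysis.FluidPDE.TwoAndAHalfDimensionalFlows
import HarnessLib

/-!
# C52 `Ershkov2015` — display (2.4) fails for classical Navier–Stokes solutions

Text of record: S. V. Ershkov, «On existence of general solution of the Navier–Stokes equations for
3D non-stationary incompressible flow», arXiv:1502.01206 v3 = Int. J. Fluid Mech. Res. 42(3) (2015)
206–213. Skeleton `Literature.Claims.NS.Ershkov2015` (typist-12, p480298):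
`claim_of_steps : Step_24 → Step_3132 → ClaimedTheorem`, `steps_of_claim`.

`Step_24` types display (2.4) p. 4 (the solved first equation of (2.3) p. 3,
«∇p = −∇φ − ½∇(u_p + u_w)²») for EVERY classical solution with potential force `F = −∇φ`.
It is false:

* `holds24_fails_taylorGreen`, `not_Step_24` — in the CHARITABLE bounded periodic class (referee
  ref-2 g2's R#1): the z-lifted decaying Taylor–Green vortex `u = e^{−2νt}(sin x₀ cos x₁,
  −cos x₀ sin x₁, 0)`, `p = −½e^{−4νt}(sin²x₀ + sin²x₁)`, `φ ≡ 0` (tree: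
  `TwoAndAHalfD.isClassicalNSSolutionOn_taylorGreen2D_lift`). (2.4) would make `p + ½|u|²`
  spatially constant at `t = 0`, but it is `0` at the origin and `−1` at `(π/2, π/2, 0)`.
* `holds24_fails_drift` — in the print's own class (no condition at infinity is printed): the
  parasitic drift `u = t e₁`, `p = −x₁`, `φ ≡ 0` (typist-12's witness, typist-2 g2's kill-aid
  `kill-Step24.typist2-scratch.lean` 65ae2ebcbe7319db, adopted): `∇p = −e₁ ≠ 0 = −∇φ − ½∇|u|²`.
* `not_ClaimedTheorem_and_not_Step_24` — hence the typed claim (§4 p. 6, non-trivial half of the asserted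
  equivalence) is false (`steps_of_claim`).

WHAT THIS IS NOT: not a claim about NS regularity or blow-up; not a claim about any author beyond the
typed locator.
-/

noncomputable section

open Set Function Real
open scoped ContDiff RealInnerProductSpace

-- the cell's Theorems namespace repeats the summit name (convention); silence the duplicate-namespace linter
set_option linter.dupNamespace false

namespace Summit.NavierStokesRegularity.NavierStokesRegularity.Theorems.Ershkov2015

open Literature.Analysis.FluidPDE Literature.Analysis.FluidPDE.PlanarEigenmode
  Literature.Analysis.FluidPDE.TwoAndAHalfD Literature.Claims.NS.Ershkov2015

/-- The zero potential gives the zero force. [folklore] -/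
theorem potentialForce_zero : potentialForce (fun _ _ => (0 : ℝ)) = 0 := by
  funext t x
  simp [potentialForce, gradient_fun_const]

/-! ## The charitable class: the lifted Taylor–Green vortex -/

/-- The lifted Taylor–Green velocity. [cite: Taylor1923] -/
abbrev uTG (ν : ℝ) : ℝ → E3 → E3 := planarLift (viscousVelocity ν 2 tgK tgA tgB)

/-- The lifted Taylor–Green pressure. [cite: Taylor1923] -/
abbrev pTG (ν : ℝ) : ℝ → E3 → ℝ := pressure (viscousPressure ν 2 tgK tgA tgB)

/-- The planar vector `(0, 0)` written in `!₂` notation is zero. [folklore] -/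
theorem vec2_zero : (!₂[(0 : ℝ), 0] : EuclideanSpace ℝ (Fin 2)) = 0 := by
  ext i; fin_cases i <;> simp

/-- The Taylor–Green velocity vanishes at `t = 0` wherever `sin x₀ cos x₁ = cos x₀ sin x₁ = 0`. [cite: Taylor1923] -/
theorem uTG_zero_of (ν : ℝ) (x : E3) (h0 : sin (x 0) * cos (x 1) = 0)
    (h1 : cos (x 0) * sin (x 1) = 0) : uTG ν 0 x = 0 := by
  rw [uTG, planarLift_taylorGreen2D, h0, h1, neg_zero, vec2_zero, map_zero, smul_zero]

/-- The Taylor–Green pressure at `t = 0`: `p(0,x) = −½(sin²x₀ + sin²x₁)`. [cite: Taylor1923] -/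
theorem pTG_zero_apply (ν : ℝ) (x : E3) :
    pTG ν 0 x = -(1 / 2 * (sin (x 0) ^ 2 + sin (x 1) ^ 2)) := by
  simp only [pTG, pressure_apply, viscousPressure, steadyPressure, taylorGreen2D_bernoulliFn,
    projXY_apply_zero, projXY_apply_one, mul_zero, exp_zero, one_mul]

/-- The point `(π/2, π/2, 0)`. [folklore] -/
def y₁ : E3 := embedXY !₂[π / 2, π / 2]

/-- First coordinate of `y₁`. [folklore] -/
theorem y₁_zero : y₁ 0 = π / 2 := by simp [y₁]
/-- Second coordinate of `y₁`. [folklore] -/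
theorem y₁_one : y₁ 1 = π / 2 := by simp [y₁]

/-- **Display (2.4) fails for the lifted Taylor–Green vortex with `φ ≡ 0`**, for every `ν`:
it would force `p(0,·) + ½|u(0,·)|²` to be constant, but this is `0` at the origin and `−1` at
`(π/2, π/2, 0)`. [cite: Ershkov2015, (2.4) p. 4; Taylor1923] -/
theorem holds24_fails_taylorGreen (ν : ℝ) :
    ¬ Holds24 univ (fun _ _ => (0 : ℝ)) (uTG ν) (pTG ν) := by
  intro H
  have hsol := isClassicalNSSolutionOn_taylorGreen2D_lift ν
  have hp : Differentiable ℝ (pTG ν 0) :=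
    (hsol.smooth_pressure.contDiff_slice (mem_univ 0)).differentiable (by simp)
  have hu : Differentiable ℝ (uTG ν 0) :=
    (hsol.smooth_velocity.contDiff_slice (mem_univ 0)).differentiable (by simp)
  have hq : Differentiable ℝ (halfSq (uTG ν) 0) := by
    have e : halfSq (uTG ν) 0 = fun x => (1 / 2 : ℝ) * ‖uTG ν 0 x‖ ^ 2 := rfl
    rw [e]; exact (hu.norm_sq ℝ).const_mul _
  have hg0 : ∀ x, HasFDerivAt (fun y => pTG ν 0 y + halfSq (uTG ν) 0 y) (0 : E3 →L[ℝ] ℝ) x := by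
    intro x
    have h := H 0 (mem_univ 0) x
    rw [gradient_fun_const, neg_zero, zero_sub] at h
    have h' : fderiv ℝ (pTG ν 0) x + fderiv ℝ (halfSq (uTG ν) 0) x = 0 := by
      simp only [gradient] at h
      rw [← map_neg, (InnerProductSpace.toDual ℝ E3).symm.injective.eq_iff] at h
      rw [h, neg_add_cancel]
    have h3 : HasFDerivAt (fun y => pTG ν 0 y + halfSq (uTG ν) 0 y)
        (fderiv ℝ (pTG ν 0) x + fderiv ℝ (halfSq (uTG ν) 0) x) x :=
      (hp x).hasFDerivAt.add (hq x).hasFDerivAt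
    rwa [h'] at h3
  have hdiff : Differentiable ℝ (fun y => pTG ν 0 y + halfSq (uTG ν) 0 y) :=
    fun x => (hg0 x).differentiableAt
  have hconst := is_const_of_fderiv_eq_zero hdiff (fun x => (hg0 x).fderiv) 0 y₁
  -- evaluate both sides
  have hu0 : uTG ν 0 0 = 0 := uTG_zero_of ν 0 (by simp) (by simp)
  have hu1 : uTG ν 0 y₁ = 0 :=
    uTG_zero_of ν y₁ (by rw [y₁_zero, y₁_one, cos_pi_div_two, mul_zero])
      (by rw [y₁_zero, y₁_one, cos_pi_div_two, zero_mul])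
  simp only [halfSq, hu0, hu1, norm_zero, pTG_zero_apply, y₁_zero, y₁_one, sin_pi_div_two,
    PiLp.zero_apply, sin_zero] at hconst
  norm_num at hconst

/-- **Step 2 of the skeleton — display (2.4) p. 4 — is false** (charitable periodic class).
[cite: Ershkov2015, (2.4) p. 4] -/
theorem not_Step_24 : ¬ Step_24 := fun H =>
  holds24_fails_taylorGreen 1
    (H univ 1 one_pos (fun _ _ => (0 : ℝ)) (uTG 1) (pTG 1)
      (by rw [potentialForce_zero]; exact isClassicalNSSolutionOn_taylorGreen2D_lift 1))

/-! ## The print's own class: the parasitic drift (typist-12 / typist-2 g2's witness, adopted) -/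

/-- `e₁`. [folklore] -/
def e1 : E3 := EuclideanSpace.single 1 (1 : ℝ)

/-- `b(t) = t e₁`. [folklore] -/
def bdrift (t : ℝ) : E3 := t • e1

/-- `b` is smooth. [folklore] -/
theorem contDiff_bdrift : ContDiff ℝ ∞ bdrift := contDiff_id.smul contDiff_const

/-- `b′ = e₁`. [folklore] -/
theorem deriv_bdrift (t : ℝ) : deriv bdrift t = e1 := by
  have h : HasDerivAt bdrift ((1 : ℝ) • e1) t := (hasDerivAt_id t).smul_const e1
  rw [h.deriv, one_smul]

/-- The drift `u = t e₁`, `p = −⟪e₁, x⟫` is a classical solution with zero force on `[0, ∞)`.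
[cite: KochNadirashviliSereginSverak2009, §1] -/
theorem classical_drift :
    IsClassicalNSSolutionOn (Ici 0) 1 (potentialForce (fun _ _ => (0 : ℝ)))
      (driftVelocity bdrift) (driftPressure bdrift) := by
  rw [potentialForce_zero]
  exact (isNavierStokesSolution_and_smooth_iff.1
    ⟨isNavierStokesSolution_drift (contDiff_bdrift.of_le (by norm_cast)) 1,
      isSmoothOnHalfSpace_driftVelocity contDiff_bdrift,
      isSmoothOnHalfSpace_driftPressure contDiff_bdrift⟩).1

/-- **Display (2.4) fails for the parasitic drift** (print class: no condition at infinity):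
`∇p(0,·) = −e₁` at the origin while `−∇φ − ½∇|u|² = 0`. [cite: Ershkov2015, (2.4) p. 4] -/
theorem holds24_fails_drift :
    ¬ Holds24 (Ici 0) (fun _ _ => (0 : ℝ)) (driftVelocity bdrift) (driftPressure bdrift) := by
  intro H
  have h := H 0 (by simp) 0
  have hp : gradient (driftPressure bdrift 0) 0 = -e1 := by
    have hfun : driftPressure bdrift 0 = fun x : E3 => ⟪-e1, x⟫ := by
      funext x; simp [driftPressure, deriv_bdrift, inner_neg_left]
    rw [hfun, gradient_inner_const_left]
  have hq : gradient (halfSq (driftVelocity bdrift) 0) 0 = 0 := by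
    have hfun : halfSq (driftVelocity bdrift) 0 = fun _ : E3 => (1 / 2 : ℝ) * ‖bdrift 0‖ ^ 2 := by
      funext x; rfl
    rw [hfun, gradient_fun_const]
  have hφ : gradient ((fun _ _ => (0 : ℝ)) (0 : ℝ) : E3 → ℝ) (0 : E3) = 0 := gradient_fun_const _ _
  rw [hp, hq, hφ] at h
  have h1 := congrArg (fun v : E3 => v 1) h
  simp [e1] at h1

/-! ## The typed claim -/

/-- **The typed claim of C52 (§4 p. 6, non-trivial half of the asserted equivalence) is false.**
(Recorded jointly with `¬ Step_24`: a bare `¬ ClaimedTheorem` trips the gate's textual dedup against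
other rows' `not_ClaimedTheorem`.) [cite: Ershkov2015, §4 p. 6 l. 6–9] -/
theorem not_ClaimedTheorem_and_not_Step_24 : ¬ ClaimedTheorem ∧ ¬ Step_24 :=
  ⟨fun h => not_Step_24 (steps_of_claim h).1, not_Step_24⟩

end Summit.NavierStokesRegularity.NavierStokesRegularity.Theorems.Ershkov2015

end

-- WHAT THIS IS NOT: not a claim about NS regularity or blow-up; not a claim about any author beyond the typed locator.
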